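import Summits.KontsevichZagierPeriods.Zeta5Search.DenomLaw.OrbitCreditHLayers

/-!
# ζ(5) search — DENOM-LAW track D3 (denom-theory-d3 g4): the H* increment — LAYER 2, single-pole case (S) PROVED (`floorLayerSingleH_holds`)
Fourth file of the seat file `HOME/denom-law/code/d3g4/lean/OrbitCredit.lean` (v5, sha256 2da4185d…; author denom-theory-d3 g4; filed by denom-engine-d2 g4
with the tree's names `LoopAndPair` / `OrbitFloorHStar`).  Proof = SYMMETRY-D3 §9.9.4 (S) as summarised in the seat file; with `noExtremalUnderH_holds` it
leaves `OrbitFloorHStar` (and the (VH) unit) conditional on `FloorLayerMultiH` alone (`orbitFloorHStar_of_multi`).  HONEST FRAMING: systematic search;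
combinatorial statements about pole classes of the cell's dual series; nothing about ζ(5); no γ moves; no irrationality claim; records in print UNMOVED.
-/
open Finset
open Summit.KontsevichZagierPeriods.Zeta5Search.WedgeDictionary (coeffV pfData dOf)
open Summit.KontsevichZagierPeriods.Zeta5Search.CasoratianValuation (InPolytope pairFloors shift casoratian)
namespace Summit.KontsevichZagierPeriods.Zeta5Search.ClusterValuation.Orbit
open Summit.KontsevichZagierPeriods.Zeta5Search.ClusterValuation
open Summit.KontsevichZagierPeriods.Zeta5Search.PadicSeries (one_le_p zpow_p_nonneg)
open Summit.KontsevichZagierPeriods.Zeta5Search.DualSeries (InBox)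
open Summit.KontsevichZagierPeriods.Zeta5Search.BigPrime (shift_zero dOf_shift)
set_option maxHeartbeats 1600000 in
/-- **LAYER 2, single-pole case (S) holds**: under LoopAndPair, in the first period of the one-carry regime, a non-tame single-pole class at the floor `E_x = −N_p` is `{x, x+p, x+2p}` of shape `(0,−6,0)` and is credited. -/
theorem floorLayerSingleH_holds : FloorLayerSingleH := by
  intro b p x hb hprime hp5 hpb hwin _hd1 _hd2 hm1 hH hx h1 htame hE
  have hp0 : 0 < p := hprime.pos
  have hp' : (0 : ℤ) < (p : ℤ) := by exact_mod_cast hp0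
  have hbox : InBox b := hb.1
  have h0 : 0 ≤ b 0 := hb.1.1
  have hb0 : (((b 0).toNat : ℕ) : ℤ) = b 0 := Int.toNat_of_nonneg h0
  have hodd : ¬ 2 ∣ p := by
    intro h2
    have := (Nat.prime_dvd_prime_iff_eq Nat.prime_two hprime).1 h2
    omega
  -- (1) the pole `q`, unique
  obtain ⟨q, hqeq⟩ := card_eq_one.1 h1
  have hqf : q ∈ (classSet b p x).filter fun s => netExp b s < 0 := by rw [hqeq]; exact mem_singleton_self q
  have hqmem : q ∈ classSet b p x := (mem_filter.1 hqf).1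
  have hqneg : netExp b q < 0 := (mem_filter.1 hqf).2
  have huniq : ∀ s ∈ classSet b p x, netExp b s < 0 → s = q := by
    intro s hs hneg
    have : s ∈ (classSet b p x).filter fun s => netExp b s < 0 := mem_filter.2 ⟨hs, hneg⟩
    rw [hqeq, mem_singleton] at this
    exact this
  have hnonneg : ∀ s ∈ classSet b p x, s ≠ q → 0 ≤ netExp b s := by
    intro s hs hne
    by_contra h
    push Not at h
    exact hne (huniq s hs h)
  -- (1b) non-tame: `q ≥ p` and a neutral point below `q`
  have hnt : ¬ (q < p ∨ ∀ s ∈ classSet b p x, s < q → 0 < netExp b s) := by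
    intro h
    have : tameSingle b p x = true := by
      unfold tameSingle
      exact decide_eq_true ⟨q, hqmem, hqneg, h⟩
    rw [htame] at this
    exact Bool.false_ne_true this
  push Not at hnt
  obtain ⟨hpq, s₀, hs₀mem, hs₀q, hs₀le⟩ := hnt
  have hs₀net : netExp b s₀ = 0 := le_antisymm hs₀le (hnonneg s₀ hs₀mem (by omega))
  -- (2) `s ≤ N`
  have hsN : netExp b q ≥ -pairFloors b p :=
    singlePoleExpBound_holds b p x q s₀ hb hp5 hodd hpb hwin hx h1 hqmem hqneg hs₀mem hs₀q hs₀net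
  -- (3) `E = net q + Σ_{others} + bonus`, all extra terms vanish
  have hsplit := add_sum_erase (classSet b p x) (fun s => netExp b s) hqmem
  have hrest_nonneg : ∀ s ∈ (classSet b p x).erase q, 0 ≤ netExp b s :=
    fun s hs => hnonneg s (mem_of_mem_erase hs) (mem_erase.1 hs).1
  have hrest0 : 0 ≤ ∑ s ∈ (classSet b p x).erase q, netExp b s := sum_nonneg hrest_nonneg
  have hbonus0 : (0 : ℤ) ≤ (if ¬ (2 : ℤ) ∣ b 0 ∧ CentreIn b p x then 1 else 0) := by split_ifs <;> norm_num
  have hE' : (netExp b q + ∑ s ∈ (classSet b p x).erase q, netExp b s) +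
      (if ¬ (2 : ℤ) ∣ b 0 ∧ CentreIn b p x then 1 else 0) = -pairFloors b p := by
    unfold classExp at hE; rw [hsplit]; exact hE
  have hrest : ∑ s ∈ (classSet b p x).erase q, netExp b s = 0 := by linarith
  have hbonus : ¬ (¬ (2 : ℤ) ∣ b 0 ∧ CentreIn b p x) := by
    intro h; rw [if_pos h] at hE'; linarith
  have hNq : netExp b q = -pairFloors b p := by linarith [show (if ¬ (2 : ℤ) ∣ b 0 ∧ CentreIn b p x then (1:ℤ) else 0) = 0 by rw [if_neg hbonus]]
  have hnet0 : ∀ s ∈ classSet b p x, s ≠ q → netExp b s = 0 := by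
    intro s hs hne
    have hmem : s ∈ (classSet b p x).erase q := mem_erase.2 ⟨hne, hs⟩
    exact (sum_eq_zero_iff_of_nonneg hrest_nonneg).1 hrest s hmem
  -- (4) the two largest blocks; `x`
  obtain ⟨j₁, hj₁, j₂, hj₂, hmin₁, hmin₂⟩ := exists_two_largest b
  have hj₁7 := mem_range.1 hj₁
  have hj₂7 := mem_range.1 (mem_erase.1 hj₂).2
  have hj₂1 : j₂ ≠ j₁ := (mem_erase.1 hj₂).1
  have hxmem : x ∈ classSet b p x := by
    unfold classSet
    rw [mem_filter, mem_range]
    refine ⟨?_, rfl⟩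
    have : (x : ℤ) < (p : ℤ) := by exact_mod_cast hx
    omega
  have hxq : x ≠ q := by omega
  have hxnet : netExp b x = 0 := hnet0 x hxmem hxq
  have hxbc : blockCount b x = 1 := blockCount_eq_one_of_netExp_eq_zero b hb hxnet
  have hx1 : x ∈ blk b j₁ := mem_largest_of_blockCount b hbox hj₁ hmin₁ (by omega)
  have hx2 : x ∉ blk b j₂ := fun h => by
    have := two_le_blockCount_of_mem b hj₁7 hj₂7 hj₂1.symm hx1 h; omega
  have hq2bc : 2 ≤ blockCount b q := two_le_blockCount_of_pole b hqneg
  have hq1 : q ∈ blk b j₁ := mem_largest_of_blockCount b hbox hj₁ hmin₁ (by omega)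
  have hq2 : q ∈ blk b j₂ := mem_second_of_blockCount b hbox hj₂ hmin₂ hq2bc
  -- `q ≥ x + p`
  have hqx : x + p ≤ q := by
    have hres : q % p = x % p := (mem_filter.1 hqmem).2
    have hxp : x % p = x := Nat.mod_eq_of_lt hx
    have hdm := Nat.div_add_mod q p
    rcases Nat.eq_zero_or_pos (q / p) with h0' | hq'
    · rw [h0', mul_zero, zero_add, hres, hxp] at hdm
      exact absurd hdm hxq
    · have := Nat.mul_le_mul_left p (show 1 ≤ q / p from hq')
      rw [hres, hxp] at hdm
      linarith
  -- (5) the star of `j₁` through the blocks containing `q`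
  set Sq := (range 7).filter fun i => q ∈ blk b i with hSq
  have hSqc : Sq.card = blockCount b q := (blockCount_eq b q).symm
  have hj₁Sq : j₁ ∈ Sq := mem_filter.2 ⟨hj₁, hq1⟩
  have memSq : ∀ i ∈ Sq, i < 7 ∧ q ∈ blk b i := fun i hi => ⟨mem_range.1 (mem_filter.1 hi).1, (mem_filter.1 hi).2⟩
  set P := (Sq.erase j₁).image fun i => (min j₁ i, max j₁ i) with hP
  have hPinj : Set.InjOn (fun i => (min j₁ i, max j₁ i)) ↑(Sq.erase j₁) := by
    intro i hi i' hi' h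
    have hi1 : i ≠ j₁ := (mem_erase.1 (mem_coe.1 hi)).1
    have hi'1 : i' ≠ j₁ := (mem_erase.1 (mem_coe.1 hi')).1
    simp only [Prod.mk.injEq] at h
    omega
  have hPcard : P.card = Sq.card - 1 := by
    rw [hP, card_image_of_injOn hPinj, card_erase_of_mem hj₁Sq]
  have hP7 : ∀ e ∈ P, e.1 < e.2 ∧ e.2 < 7 := by
    intro e he
    obtain ⟨i, hi, rfl⟩ := mem_image.1 he
    have hi1 : i ≠ j₁ := (mem_erase.1 hi).1
    have hi7 := (memSq i (mem_of_mem_erase hi)).1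
    simp only
    omega
  have hPlarge : ∀ e ∈ P, 1 ≤ pairTerm b p e.1 e.2 := by
    intro e he
    obtain ⟨i, hi, rfl⟩ := mem_image.1 he
    obtain ⟨hi7, hqi⟩ := memSq i (mem_of_mem_erase hi)
    exact one_le_pairTerm_cross b hb hp0 hj₁7 hi7 hx1 hqi hqx
  have hNP : (P.card : ℤ) ≤ pairFloors b p := card_le_pairFloors b hb p P hP7 hPlarge
  -- adding one more large pair outside `P` is impossible once `N = #P`
  have hbcq : (blockCount b q : ℤ) - 1 ≤ pairFloors b p := by
    have : ((Sq.card - 1 : ℕ) : ℤ) = (Sq.card : ℤ) - 1 := by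
      have : 1 ≤ Sq.card := card_pos.2 ⟨j₁, hj₁Sq⟩
      omega
    rw [← hSqc, ← this, ← hPcard]; exact hNP
  -- `net q = 1 − bc(q) + [centre]`, so `N = bc(q) − 1` and `q` is not the even centre
  have hqcentre : ¬ 2 * (q : ℤ) = b 0 := by
    intro hc
    unfold netExp at hNq; rw [if_pos hc] at hNq
    omega
  have hNbc : pairFloors b p = (blockCount b q : ℤ) - 1 := by
    unfold netExp at hNq; rw [if_neg hqcentre] at hNq; omega
  have hextra : ∀ e : ℕ × ℕ, e.1 < e.2 → e.2 < 7 → 1 ≤ pairTerm b p e.1 e.2 → e ∈ P := by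
    intro e he1 he2 hel
    by_contra hne
    have hc := card_le_pairFloors b hb p (insert e P)
      (by intro f hf; rw [mem_insert] at hf; rcases hf with rfl | hf; exact ⟨he1, he2⟩; exact hP7 f hf)
      (by intro f hf; rw [mem_insert] at hf; rcases hf with rfl | hf; exact hel; exact hPlarge f hf)
    rw [card_insert_of_notMem hne] at hc
    push_cast at hc
    have : (P.card : ℤ) = (blockCount b q : ℤ) - 1 := by
      rw [hPcard, hSqc]
      have : 1 ≤ blockCount b q := by omega
      omega
    linarith
  -- (6) the H pair is one of the star pairs: `J ∈ Sq`, i.e. `q ∈ B_J`, with `b_J ≥ p`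
  obtain ⟨j, hj, hloop, k, hk, hkj, hpair⟩ := hH
  rw [Finset.mem_Icc] at hj hk
  set J := j - 1 with hJ
  set K := k - 1 with hK
  have hJ7 : J < 7 := by omega
  have hK7 : K < 7 := by omega
  have hJK : J ≠ K := by omega
  have hβJ : 0 ≤ b (J + 1) := (hb.1.2 J (mem_range.2 hJ7)).1
  have hbJ : (((b (J + 1)).toNat : ℕ) : ℤ) = b (J + 1) := Int.toNat_of_nonneg hβJ
  have hJj : J + 1 = j := by omega
  have hloopJ : (p : ℤ) ≤ b (J + 1) := by rw [hJj]; exact hloop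
  have hJKterm : 1 ≤ pairTerm b p (min J K) (max J K) := by
    rcases Nat.lt_or_gt_of_ne hkj with h | h
    · rw [min_eq_right (by omega : K ≤ J), max_eq_left (by omega : K ≤ J)]
      unfold pairTerm
      rw [show K + 1 = k by omega, hJj]
      exact Int.le_ediv_of_mul_le hp' (by linarith)
    · rw [min_eq_left (by omega : J ≤ K), max_eq_right (by omega : J ≤ K)]
      unfold pairTerm
      rw [show K + 1 = k by omega, hJj]
      exact Int.le_ediv_of_mul_le hp' (by linarith)
  have hJKmem := hextra (min J K, max J K) (by simp only; omega) (by simp only; omega) hJKterm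
  obtain ⟨i, hi, hieq⟩ := mem_image.1 hJKmem
  have hi1 : i ≠ j₁ := (mem_erase.1 hi).1
  obtain ⟨hi7, hqi⟩ := memSq i (mem_of_mem_erase hi)
  simp only [Prod.mk.injEq] at hieq
  -- `J ≠ j₁` because `b_{j₁} ≤ x < p ≤ b_J`
  have hx1' := ((mem_blk b j₁ x).1 hx1).1
  have hβ1 : 0 ≤ b (j₁ + 1) := (hb.1.2 j₁ hj₁).1
  have hb1 : (((b (j₁ + 1)).toNat : ℕ) : ℤ) = b (j₁ + 1) := Int.toNat_of_nonneg hβ1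
  have hJne1 : J ≠ j₁ := by
    intro h
    have h4 : (((b (j₁ + 1)).toNat : ℕ) : ℤ) ≤ (x : ℤ) := by exact_mod_cast hx1'
    have h5 : (x : ℤ) < (p : ℤ) := by exact_mod_cast hx
    rw [h] at hloopJ
    linarith
  have hJi : J = i := by omega
  have hqJ : q ∈ blk b J := by rw [hJi]; exact hqi
  -- (7) the top point `T = τ x`
  set T := (b 0).toNat - ((b 0).toNat - x) % p with hT
  have hpx := palTau_class b hp0 hx hxmem
  simp only [Nat.sub_self, Nat.sub_zero] at hpx
  obtain ⟨hTmem, _, hTT, hTsum⟩ := hpx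
  have hmodlt := Nat.mod_lt ((b 0).toNat - x) hp0
  have hxle : x ≤ (b 0).toNat := le_of_mem_classSet b hxmem
  have hTgt : (b 0).toNat < T + p := by omega
  have hTJ : T ∉ blk b J := by
    intro h
    have h2 := ((mem_blk b J T).1 h).2
    have h3 : ((p : ℕ) : ℤ) ≤ (((b (J + 1)).toNat : ℕ) : ℤ) := by rw [hbJ]; exact hloopJ
    have h4 : p ≤ (b (J + 1)).toNat := by exact_mod_cast h3
    omega
  have hTq : T ≠ q := fun h => hTJ (h ▸ hqJ)
  have hTnet : netExp b T = 0 := hnet0 T hTmem hTq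
  have hTbc : blockCount b T = 1 := blockCount_eq_one_of_netExp_eq_zero b hb hTnet
  have hT1 : T ∈ blk b j₁ := mem_largest_of_blockCount b hbox hj₁ hmin₁ (by omega)
  have hT2 : T ∉ blk b j₂ := fun h => by
    have := two_le_blockCount_of_mem b hj₁7 hj₂7 hj₂1.symm hT1 h; omega
  -- `q ≤ T` (levels) hence `q < T`
  have hqT : q < T := by
    have hle := (palTau_eq b hp0 hx hqmem).1
    have hres : q % p = x % p := (mem_filter.1 hqmem).2
    have hxp : x % p = x := Nat.mod_eq_of_lt hx
    have hdm := Nat.div_add_mod q p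
    rw [hres, hxp] at hdm
    have := Nat.mul_le_mul_left p hle
    have hqle : q ≤ T := by omega
    omega
  -- (8) span counting in the two largest blocks: `nB j₁ ≥ 3`, `nB j₂ ≥ 1`, (F1), `pairTerm j₁ j₂ ≤ 1`
  have hn1 : 3 ≤ nB b p x j₁ := by
    unfold nB
    have hsub : ({x, q, T} : Finset ℕ) ⊆ (classSet b p x).filter fun s => s ∈ blk b j₁ := by
      intro s hs
      simp only [mem_insert, mem_singleton] at hs
      rw [mem_filter]
      rcases hs with rfl | rfl | rfl
      · exact ⟨hxmem, hx1⟩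
      · exact ⟨hqmem, hq1⟩
      · exact ⟨hTmem, hT1⟩
    have hc : ({x, q, T} : Finset ℕ).card = 3 := by
      rw [card_insert_of_notMem, card_pair]
      · omega
      · rw [mem_insert, mem_singleton]; omega
    have := card_le_card hsub
    omega
  have hn2 : 1 ≤ nB b p x j₂ := by
    unfold nB
    exact card_pos.2 ⟨q, mem_filter.2 ⟨hqmem, hq2⟩⟩
  have hF1 := floorFact1 b hb hp0 hj₁7 hj₂7 (by omega) hn2
  have hpt : pairTerm b p j₁ j₂ ≤ 1 := by
    have hm := pair_le_mOne b hj₁7 hj₂7 hj₂1.symm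
    unfold pairTerm
    have : (b 0 - b (j₁ + 1) - b (j₂ + 1)) / (p : ℤ) < 2 := by
      rw [Int.ediv_lt_iff_lt_mul hp']; linarith
    omega
  have hn1eq : nB b p x j₁ = 3 := by
    have : ((nB b p x j₁ : ℤ) - 1) + ((nB b p x j₂ : ℤ) - 1) ≤ 2 := by linarith
    omega
  -- (9) every class point lies in `B_{j₁}`, so the class is `{x, q, T}`
  have hall1 : ∀ s ∈ classSet b p x, s ∈ blk b j₁ := by
    intro s hs
    by_cases hsq : s = q
    · rw [hsq]; exact hq1
    · have := blockCount_eq_one_of_netExp_eq_zero b hb (hnet0 s hs hsq)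
      exact mem_largest_of_blockCount b hbox hj₁ hmin₁ (by omega)
  have hcard : (classSet b p x).card = 3 := by
    have : (classSet b p x).filter (fun s => s ∈ blk b j₁) = classSet b p x := filter_true_of_mem hall1
    unfold nB at hn1eq; rw [this] at hn1eq; exact hn1eq
  have hclass : classSet b p x = {x, q, T} := by
    symm
    refine eq_of_subset_of_card_le (fun s hs => ?_) (by
      rw [hcard, card_insert_of_notMem, card_pair]
      · omega
      · rw [mem_insert, mem_singleton]; omega)
    simp only [mem_insert, mem_singleton] at hs
    rcases hs with rfl | rfl | rfl
    · exact hxmem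
    · exact hqmem
    · exact hTmem
  -- (10) the reflection fixes `q`: `τ q ∈ {x, q, T}` and `τ` is an involution with `τ x = T`
  have hpq := palTau_class b hp0 hx hqmem
  obtain ⟨hτqmem, _, hττq, hτqsum⟩ := hpq
  have hτq : (b 0).toNat - ((b 0).toNat - x) % p - (q - x) = q := by
    rw [hclass] at hτqmem
    simp only [mem_insert, mem_singleton] at hτqmem
    rcases hτqmem with h | h | h
    · -- τ q = x ⇒ q = τ x = T
      exfalso
      rw [h] at hττq
      simp only [Nat.sub_self, Nat.sub_zero] at hττq
      omega
    · exact h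
    · -- τ q = T ⇒ q = τ T = x
      exfalso
      rw [h] at hττq
      omega
  -- (11) `2q = x + T`, `T ≥ q + p`
  have h2q : 2 * q = x + T := by rw [hτq] at hτqsum; omega
  have hTq' : q + p ≤ T := by omega
  -- (12) every block contains `q` (an unhit block `u` would have `2 b_u > b₀`)
  have hallq : ∀ u ∈ range 7, q ∈ blk b u := by
    intro u hu
    have hu7 := mem_range.1 hu
    by_contra hnot
    have huSq : u ∉ Sq := fun h => hnot (mem_filter.1 h).2
    have huj : u ≠ j₁ := fun h => huSq (h ▸ hj₁Sq)
    -- the pair (j₁, u) is not in `P`, hence small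
    have hsmall : pairTerm b p (min j₁ u) (max j₁ u) < 1 := by
      by_contra hge
      push Not at hge
      have hmem := hextra (min j₁ u, max j₁ u) (by simp only; omega) (by simp only; omega) hge
      obtain ⟨i', hi', hieq'⟩ := mem_image.1 hmem
      have hi'1 : i' ≠ j₁ := (mem_erase.1 hi').1
      simp only [Prod.mk.injEq] at hieq'
      have : i' = u := by omega
      exact huSq (this ▸ mem_of_mem_erase hi')
    have hβu : 0 ≤ b (u + 1) := (hb.1.2 u hu).1
    have hhu : 2 * b (u + 1) ≤ b 0 := hb.2.1 u hu
    have hval : b 0 - b (j₁ + 1) - b (u + 1) < (p : ℤ) := by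
      by_contra hge
      push Not at hge
      have h1 : 1 ≤ pairTerm b p (min j₁ u) (max j₁ u) := by
        rcases le_total j₁ u with h | h
        · rw [min_eq_left h, max_eq_right h]; unfold pairTerm
          exact Int.le_ediv_of_mul_le hp' (by linarith)
        · rw [min_eq_right h, max_eq_left h]; unfold pairTerm
          exact Int.le_ediv_of_mul_le hp' (by linarith)
      omega
    have hT1' := ((mem_blk b j₁ T).1 hT1).2
    have e1 : (((b (j₁ + 1)).toNat : ℕ) : ℤ) ≤ (x : ℤ) := by exact_mod_cast hx1'
    have e2 : (T : ℤ) + (((b (j₁ + 1)).toNat : ℕ) : ℤ) ≤ (((b 0).toNat : ℕ) : ℤ) := by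
      have : T + (b (j₁ + 1)).toNat ≤ (b 0).toNat := by omega
      exact_mod_cast this
    have e3 : (x : ℤ) + (p : ℤ) ≤ (q : ℤ) := by exact_mod_cast hqx
    have e4 : (q : ℤ) + (p : ℤ) ≤ (T : ℤ) := by exact_mod_cast hTq'
    -- b_u > b₀ − p − b_{j₁} ≥ b₀ − q and ≥ q
    nlinarith
  have hbc7 : blockCount b q = 7 := by
    rw [blockCount_eq]
    have : (range 7).filter (fun i => q ∈ blk b i) = range 7 := filter_true_of_mem hallq
    rw [this, card_range]
  have hNq6 : netExp b q = -6 := by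
    unfold netExp; rw [if_neg hqcentre, hbc7]; norm_num
  -- (13) assemble the credit
  refine ⟨fun h => by rw [htame] at h; exact Bool.false_ne_true h.2, ?_, ?_, ?_⟩
  · -- not self-conjugate
    intro hc
    by_cases h2 : (2 : ℤ) ∣ b 0
    · obtain ⟨m, hm⟩ := h2
      have hm0 : 0 ≤ m := by omega
      set c := m.toNat with hcdef
      have hcm : ((c : ℕ) : ℤ) = m := Int.toNat_of_nonneg hm0
      have hcc : 2 * (c : ℤ) = b 0 := by rw [hcm, hm]
      -- `c` is a class point
      have hcmem : c ∈ classSet b p x := by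
        unfold classSet
        rw [mem_filter, mem_range]
        refine ⟨by omega, ?_⟩
        unfold CentreIn at hc
        have hdvd : (p : ℤ) ∣ 2 * ((x : ℤ) - c) := by rw [mul_sub, hcc]; exact hc
        have hp2 : ¬ (p : ℤ) ∣ 2 := by
          intro h
          have := Int.le_of_dvd (by norm_num) h
          have : (p : ℤ) ≥ 5 := by exact_mod_cast hp5
          linarith
        have hpr : Prime (p : ℤ) := Nat.prime_iff_prime_int.1 hprime
        have hdvd' : (p : ℤ) ∣ (x : ℤ) - c := by
          rcases hpr.dvd_or_dvd hdvd with h | h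
          · exact absurd h hp2
          · exact h
        have hmod : (c : ℤ) ≡ (x : ℤ) [ZMOD (p : ℤ)] := Int.modEq_iff_dvd.2 hdvd'
        have := Int.natCast_modEq_iff.1 hmod
        exact this
      have hcbc := blockCount_centre b hb hcc
      have hcnet : netExp b c < 0 := by unfold netExp; rw [if_pos hcc, hcbc]; norm_num
      have hcq := huniq c hcmem hcnet
      rw [hcq] at hcc
      exact hqcentre hcc
    · exact hbonus ⟨h2, hc⟩
  · -- frame-palindromic
    intro s hs
    rw [hclass] at hs
    simp only [mem_insert, mem_singleton] at hs
    rcases hs with rfl | rfl | rfl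
    · simp only [Nat.sub_self, Nat.sub_zero]
      rw [hTnet]; exact hxnet
    · rw [hτq]
    · rw [hTT, hTnet, hxnet]
  · -- even exponent
    rw [hE, hNbc, hbc7]
    exact ⟨-3, by norm_num⟩

/-- **`OrbitFloorHStar` is now conditional on the multi-pole floor case alone.** -/
theorem orbitFloorHStar_of_multi (hT : FloorLayerMultiH) : OrbitFloorHStar :=
  orbitFloorHStar_of_floorCases floorLayerSingleH_holds hT

end Summit.KontsevichZagierPeriods.Zeta5Search.ClusterValuation.Orbit
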